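import Literature.MathematicalPhysics.QuantumFieldTheory.Balaban1983to89.B8Eq113ClassBk
import Literature.MathematicalPhysics.QuantumFieldTheory.Balaban1983to89.B9Eq335RegularityClasses

/-!
# `Balaban1983to89.B8Eq133Hypotheses` — T. Bałaban, *Spaces of regular gauge field configurations on a lattice and gauge fixing
# conditions*, Commun. Math. Phys. **99** (1985) 75–102 [Balaban1985RegularSpaces], Sect. C p. 82, **THE HYPOTHESES (1.33)–(1.35) OF
# THEOREMS 2 AND 4 TYPED WITH THEIR BODIES AS ONE CONJUNCTION** on the ℤᵈ lineage carriers — (1.33) `U₀ ∈ 𝔄_k({Ω_j}, α₀)` AND «U₀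
# satisfies the regularity condition (3.35) in [4]» with [4]'s class (3.35) IN ITS CONCRETE TYPED FORM (`B9Eq335RegularityClasses.Reg335`,
# transported to this carrier), (1.34) `U′U₀ ∈ 𝔄_k({Ω_j}, α₀) ∩ Ax_k(𝔅_k, U₀)`, (1.35) `|(U′U₀)‾ʲ − Ū₀ʲ| < α₁ on Λ_j` — and the p. 82
# sentence «It is satisfied if V is close to Ū₀ʲ, more precisely if |V − Ū₀ʲ| < α₁» PROVED (row **B8.Eq1.33**; READING-RULE audit
# `lit-balaban-r05/READING-RULE-AUDIT-B8-g69.md` §3.7, the owed member)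

statement-level skeleton of published theorems with citation tags; proofs where landed; nothing here is a claim about the Yang–Mills mass gap

PDF held: `paper:balaban1985-cmp99-regular-spaces-gauge-fixing` (journal page = PDF page + 74); p. 82 [PDF 8] read AS IMAGE this session
(render `run/shared/lean/pub/pub-balaban/b2b-balaban-ref1/pages/1985-cmp99-regular-spaces-gauge-fixing/1985-cmp99-regular-spaces-gauge-fixing-p008-x2.png`);
[4] = T. Bałaban, *Propagators for lattice gauge theories in a background field*, Commun. Math. Phys. **99** (1985) 389–434
[Balaban1985BackgroundPropagators], p. 396 [PDF 8] (3.35) read on the text layer this session (`paper:balaban1985-cmp99-background-propagators`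
p0008.txt L8–30) and through r06's verbatim quotation in `B9Eq335RegularityClasses` (referee-signed).

CITATION HEADER (lean-in-tree rule).  Cell `lit-balaban` (HOME `run/shared/lean/pub/lit-balaban/`), unit `lit-balaban-r05` gen 71 (B8 reader/typer
and fold owner).  WHAT IS REPRODUCED = SKELETON row **B8.Eq1.33** ((1.33)–(1.35) p. 82, kind DEF (hypotheses)), the OWED MEMBER named by the
READING-RULE audit of block B8 (r05 gen 69, §3.7: «neither triple is ONE typed conjunction WITH BODY on the carrier of record … OWED MEMBERS:
`Hyp133to135 := InAk U₀ ∧ Reg335 U₀ ∧ InAk (U′*U₀) ∧ InAx … U₀ (U′*U₀) ∧ (∀ j ≤ k, ∀ level-j bonds in Λ_j, ‖avgIter (U′*U₀) j b −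
avgIter U₀ j b‖ < α₁)` with `Reg335` from the B9 lineage»); companion of r13 g99's `B8Eq113ClassBk.Class128` ((1.28), the same carrier and
letters).  Carrier of record = the ℤᵈ lattices of the pub-balaban lineage `B7Prop1Explicit` (sites `Fin d → ℤ`, bond fields
`Site d → Fin d → 𝔸ˣ`, `𝔸` a complete normed ℂ-algebra ⊇ `M_N(ℂ)`) — print's own «arbitrary lattice» licence (p. 76/77).

WHAT IS PRINTED (verbatim, p. 82 [PDF 8]).  *"At first let us formulate precisely the assumptions we have to make on the configurations U₀,
U = U′U₀. We assume that:  U₀ ∈ 𝔄_k({Ω_j}, α₀),  U₀ satisfies the regularity condition (3.35) in [4]. (1.33)  U′U₀ ∈ 𝔄_k({Ω_j}, α₀) ∩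
Ax_k(𝔅_k, U₀), (1.34)  |(U′U₀)‾ʲ − Ū₀ʲ| < α₁ on Λ_j, j = 0, 1, …, k. (1.35)  We need the second condition in (1.33) to apply all the
results of [4] on propagators with the background gauge field configuration U₀. We will see later that this condition is a consequence of
the first one in (1.33), so eventually we will drop it out of the assumptions. The condition (1.35) replaces the equalities for the averages
in the conditions (1.28). It is satisfied if V is close to Ū₀ʲ, more precisely if |V − Ū₀ʲ| < α₁."*  [4] p. 396: *"for an arbitrary cube □
of the described above class, and for a configuration U there exists a gauge transformation u on □ such that U^u = e^{iηA}. and if the index of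
□ is j, then |A| < O(1)Mα₀(Lʲη)⁻¹, |∇^ηA| < O(1)Mα₀(Lʲη)⁻² on □, where O(1)M is a size of □ in T_{Lʲη}; (3.35)"*.

THE READING (dictionary print ↦ Lean).  `𝔄_k({Ω_j}, α₀)` = `B8Ineq132.InAk L k η α₀ Ω` ((1.7) ∧ (1.9), p. 77 bond/plaquette convention);
`Ax_k(𝔅_k, U₀)` = `B8Eq119TwistedAxial.InAx L k Λ U₀` ((1.19)–(1.20) p. 79, `Λ_j` in level-`j` coordinates); the product `U′U₀` = the
pointwise product `U′ * U₀` of bond fields (as in `B8Eq119TwistedAxial.Thm4At`, `B8Eq113ClassBk.Class128`); the averages `Ūʲ` = the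
iterated [3] averages `B7Prop2Explicit.avgIter L U j` (configurations on `T^{(j)}`, indexed by level-`j` sites); «on Λ_j» for the bond
functions of (1.35) = the p. 77 convention, every level-`j` bond with at least one end-point in `Λ_j` (`B8Eq113ClassBk.bondsOn Λ j`, r13's
reading of (1.13)); `|·|` = the norm of `𝔸`.  «(3.35) in [4]» = r06's typed class `B9Eq335RegularityClasses.Reg335 T U η L 𝒬 C` on the
abstract lattice of the B9 files (sites `S`, directions `ι`, shifts `T : ι → Equiv.Perm S`, bond field `U : ι → S → 𝔸ˣ`) TRANSPORTED to this
carrier by `S := Site d`, `ι := Fin d`, `T κ := (· + e_κ)` (`shiftT`), `U κ x := U₀ x κ` (`byDir`) — under which [4]'s gauge action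
`B9Eq3117Current.gaugeTr` (3.28) IS [3]'s `B7Prop1Explicit.gaugeAct` (`gaugeTr_byDir`); the cube class of [4] p. 396 («the described above
class», SKELETON row B9.Def@396 — a PARAMETER family there too, ref-3 N-g93-1) enters as the parameter `𝒬 : Set (Set (Site d) × ℕ)` (cube,
index), the constant «O(1)Mα₀» as `C`.

WHAT THIS MODULE PROVES (0 sorry, 0 `def … : Prop` WITHOUT BODY — every `def` below has its body; theorems are unfoldings, projections, the
p. 82 sentence and a non-vacuity witness; imports `B8Eq113ClassBk` (r13 g99) + `B9Eq335RegularityClasses` (r06)).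
§1 the transport letters `shiftT`, `byDir` with `gaugeTr_byDir` ([4] (3.28) `U^u` = [3] (9) `gaugeAct`, definitionally up to the letters).
§2 **`Reg335Zd η L 𝒬 C U₀`** := «U₀ satisfies the regularity condition (3.35) in [4]» on this carrier (r06's `Reg335` transported), with its
   unfolding `reg335Zd_iff` in B8 letters and the trivial-background instance `reg335Zd_one` (`u = 1`, `A = 0`; `C > 0`).
§3 **`Hyp133`** = (1.33), **`Hyp134`** = (1.34), **`Hyp135`** = (1.35), **`Hyp133to135`** = their conjunction — WITH BODIES, verbatim —, the
   unfoldings and projections, and **`hyp135_of_inBk`** = the p. 82 sentence «The condition (1.35) replaces the equalities for the averages in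
   the conditions (1.28). It is satisfied if V is close to Ū₀ʲ, more precisely if |V − Ū₀ʲ| < α₁» PROVED: `U′U₀ ∈ 𝔅_k(𝔅_k, V)` (r13's
   `B8Eq113ClassBk.InBk`, (1.13)/(1.28)) and `|V − Ū₀ʲ| < α₁` on `Λ_j` give (1.35).
§4 non-vacuity: **`hyp133to135_one`** — the pair `U₀ = 1`, `U′ = 1` satisfies (1.33)–(1.35) for every `α₀, α₁, C > 0` (p. 98 «identically
   equal to 1 satisfies, of course, all possible regularity conditions»).

HONEST SCOPE / NOT CLAIMED.  (i) DEFINITIONS (hypotheses) only: nothing of Theorems 2/4 is proved here; `B8Eq119TwistedAxial.Thm4At` (p40)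
already displays (1.33)/(1.34)/(1.66) with «(3.35)» as an ABSTRACT predicate `Reg` — this file supplies the concrete `Reg := Reg335Zd η L 𝒬 C`
and the (1.35) clause (Theorem 2's form; Theorem 4 uses (1.66), `B8Prop6OfThm4.Cond166`, obtained from (1.33)–(1.35) by (1.65) —
`B8Ineq165Local/Descent`, not re-derived here).  (ii) [4]'s cube class is a PARAMETER `𝒬` (print's defining condition of p. 396 — unique
index `j`, `□ ⊂ B^j(Λ_j) ∪ B^{j+1}(Λ_{j+1})`, `□ ∩ B^j(Λ_j) ≠ ∅`, unions of big blocks — is row B9.Def@396's, typed there as coordinate-box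
geometry with the class a parameter); the constant «O(1)Mα₀» is the parameter `C`; (3.35)'s `u` is of unitary type on `□` (`‖u‖, ‖u⁻¹‖ ≦ 1`,
r06's reading; print: `G`-valued), its `∇^η` the FLAT forward difference (background `1` inside the cube chart, r06's reading of p. 396).
(iii) (1.35) is typed with print's strict `<` and the p. 77 bond convention; consumers using `≦` on box regions (`B8Ineq165Local.ineq165_local`'s
`h35`) get it from `Hyp135.norm_sub_le`.  (iv) `|·|` = the norm of the ambient algebra `𝔸` (print: operator norm on `M_N(ℂ)`); «U has values
in G» is not part of (1.33)–(1.35) and is carried by the consumers (`Thm4At`'s `G`).  (v) Row B8.Eq1.33 cells; no head of a theorem row moves;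
nothing here bears on the Yang–Mills mass gap.

RELATED IN THE TREE, NOT DUPLICATED (stem check 2026-08-24T17:1xZ: `ls Balaban1983to89 | grep -i 'Eq133\|Hyp13\|Class133'` = `B8Ineq133`
((1.133), Sect. F), `B5Eq133G0Torus`, `B16Eq133NewDeterminingSet` — unrelated numbers of other papers; `grep -l Reg335 B8*.lean` = ∅).  USED BY
NAME: `B8Ineq132.InAk` (pub-balaban lineage), `B8Eq119TwistedAxial.InAx`/`inAx_self` (p40), `B8Eq113ClassBk.InBk`/`bondsOn`/`inBk_iff` (r13
g99), `B7Prop2Explicit.avgIter`/`B8Ineq132.avgIter_one`, `B7Prop1Explicit.gaugeAct`/`e`, `B8Prop6OfThm4.one_inAk` (r05 g21),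
`B9Eq335RegularityClasses.Reg335`/`Reg335Cube` (r06), `B9Eq3117Current.gaugeTr`, `B9Eq39Adjoint.covD`/`fluct`/`covD_zero` (B9 lineage),
`LatticeNorms.scaleLen`.
-/

open scoped BigOperators

namespace Literature.MathematicalPhysics.QuantumFieldTheory.Balaban1983to89.B8Eq133Hypotheses

open Literature.MathematicalPhysics.QuantumLattice (ZdEdge)
open B7Prop1Explicit (e gaugeAct U1)
open B7Prop2Explicit (avgIter)
open B8Ineq132 (InAk avgIter_one)
open B8Eq119TwistedAxial (InAx inAx_self)
open B8Eq113ClassBk (InBk InBkOn bondsOn inBk_iff)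
open B8Prop6OfThm4 (one_inAk)
open B9Eq335RegularityClasses (Reg335 Reg335Cube)
open B9Eq3117Current (gaugeTr)
open B9Eq39Adjoint (covD fluct covD_zero)
open LatticeNorms (scaleLen scaleLen_pos)

-- `Site` alone would resolve to the torus sites of `Setup.lean`; re-export the `ℤ^d` sites of `B7Prop1Explicit` (as `B8Eq113ClassBk` does).
export B7Prop1Explicit (Site)

noncomputable section

variable {d : ℕ}

/-! ## §1 The transport of [4]'s abstract lattice letters to the ℤᵈ carrier -/

/-- the shifts `x ↦ x + e_κ` of the lattice `ℤᵈ`, as the permutations `T_κ` of [4]'s abstract lattice (`B9Eq39Adjoint`: sites `S`,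
directions `ι`, `T : ι → Equiv.Perm S`). [cite: Balaban1985BackgroundPropagators, (3.3) p.390 (the shifted site `x + ηe_μ`); Balaban1985RegularSpaces, (1.1) p.76] -/
def shiftT (d : ℕ) : Fin d → Equiv.Perm (Site d) := fun κ => Equiv.addRight (e κ)

/-- a bond field of the ℤᵈ carrier (`U x κ` = the variable of the bond `⟨x, x + e_κ⟩`) read in [4]'s letter order `U κ x`.
[cite: Balaban1985BackgroundPropagators, (3.1) p.390; Balaban1985RegularSpaces, p.76 §A] -/
def byDir {G : Type*} (U : Site d → Fin d → G) : Fin d → Site d → G := fun κ x => U x κ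

/-- `T_κ x = x + e_κ`. [cite: Balaban1985BackgroundPropagators, (3.3) p.390] -/
@[simp] theorem shiftT_apply (κ : Fin d) (x : Site d) : shiftT d κ x = x + e κ := rfl

/-- `(byDir U) κ x = U x κ`. [cite: Balaban1985BackgroundPropagators, (3.1) p.390] -/
@[simp] theorem byDir_apply {G : Type*} (U : Site d → Fin d → G) (κ : Fin d) (x : Site d) : byDir U κ x = U x κ := rfl

/-- `byDir 1 = 1`. [cite: Balaban1985RegularSpaces, p.98 («the configuration is equal to 1»)] -/
@[simp] theorem byDir_one {G : Type*} [One G] : byDir (1 : Site d → Fin d → G) = 1 := rfl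

/-- **[4]'s gauge action (3.28) `U^u(x, x′) = u(x)U(x, x′)u(x′)⁻¹` on the transported data IS [3]'s `gaugeAct`** ((1.15)–(1.17) of this
paper): `gaugeTr T u (byDir U) = byDir (gaugeAct u U)`. [cite: Balaban1985BackgroundPropagators, (3.28) p.395; Balaban1985RegularSpaces, (1.15)–(1.17) p.78] -/
theorem gaugeTr_byDir {𝔸 : Type*} [Ring 𝔸] (u : Site d → 𝔸ˣ) (U : Site d → Fin d → 𝔸ˣ) :
    gaugeTr (shiftT d) u (byDir U) = byDir (gaugeAct u U) := by
  funext κ x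
  simp [gaugeTr, gaugeAct, byDir, shiftT]

/-! ## §2 «U₀ satisfies the regularity condition (3.35) in [4]» on the ℤᵈ carrier -/

section Reg

variable {𝔸 : Type*} [NormedRing 𝔸] [NormedAlgebra ℂ 𝔸] [CompleteSpace 𝔸]

/-- **«U₀ satisfies the regularity condition (3.35) in [4]»** (the second clause of (1.33)) for a bond field `U₀` of the ℤᵈ carrier: r06's
typed class (3.35) `B9Eq335RegularityClasses.Reg335` — for every cube `□` of the class `𝒬` with index `j`, a gauge transformation `u` on `□`
of unitary type with `U₀^u = e^{iηA}` on `□` and `|A| < C(Lʲη)⁻¹`, `|∇^ηA| < C(Lʲη)⁻²` on `□` (`C` = «O(1)Mα₀») — transported by `shiftT`/`byDir`;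
the cube class of [4] p. 396 is the parameter `𝒬`. [cite: Balaban1985RegularSpaces, (1.33) p.82; Balaban1985BackgroundPropagators, (3.35) p.396] -/
def Reg335Zd (η : ℝ) (L : ℕ) (𝒬 : Set (Set (Site d) × ℕ)) (C : ℝ) (U₀ : Site d → Fin d → 𝔸ˣ) : Prop :=
  Reg335 (shiftT d) (byDir U₀) η (L : ℝ) 𝒬 C

/-- **(3.35) unfolded in this paper's letters**: for every `(□, j) ∈ 𝒬` there are `u : Site d → 𝔸ˣ` and `A : Fin d → Site d → 𝔸` with
`‖u‖, ‖u⁻¹‖ ≦ 1` on `□`, `(U₀^u)(z, z + e_κ) = e^{iηA_κ(z)}` for `z ∈ □` (`gaugeAct`), `‖A_κ(z)‖ < C(Lʲη)⁻¹` and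
`‖η⁻¹(A_ν(z + e_κ) − A_ν(z))‖ < C((Lʲη)²)⁻¹` on `□`. [cite: Balaban1985BackgroundPropagators, (3.35) p.396, (3.28) p.395; Balaban1985RegularSpaces, (1.33) p.82] -/
theorem reg335Zd_iff (η : ℝ) (L : ℕ) (𝒬 : Set (Set (Site d) × ℕ)) (C : ℝ) (U₀ : Site d → Fin d → 𝔸ˣ) :
    Reg335Zd η L 𝒬 C U₀ ↔ ∀ q ∈ 𝒬, ∃ (u : Site d → 𝔸ˣ) (A : Fin d → Site d → 𝔸),
      (∀ z ∈ q.1, ‖(u z : 𝔸)‖ ≤ 1 ∧ ‖(((u z)⁻¹ : 𝔸ˣ) : 𝔸)‖ ≤ 1) ∧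
      (∀ κ, ∀ z ∈ q.1, byDir (gaugeAct u U₀) κ z = fluct η A κ z) ∧
      (∀ κ, ∀ z ∈ q.1, ‖A κ z‖ < C * (scaleLen (L : ℝ) η q.2)⁻¹) ∧
      (∀ κ ν, ∀ z ∈ q.1, ‖((η : ℂ)⁻¹) • covD (shiftT d) (fun _ _ => (1 : 𝔸ˣ)) κ (A ν) z‖ < C * (scaleLen (L : ℝ) η q.2 ^ 2)⁻¹) := by
  simp only [Reg335Zd, Reg335, Reg335Cube, gaugeTr_byDir]

/-- `e^{iη·0} = 1`: the fluctuation field of `A = 0` is the trivial configuration. [cite: Balaban1985BackgroundPropagators, p.390 («U′ = exp iηA′»)] -/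
theorem fluct_zero (η : ℝ) (κ : Fin d) (z : Site d) : fluct (S := Site d) η (0 : Fin d → Site d → 𝔸) κ z = 1 := by
  ext
  simp [fluct]

/-- **THE TRIVIAL BACKGROUND IS REGULAR** (p. 98: «The configuration … identically equal to 1 satisfies, of course, all possible regularity
conditions»): `U₀ = 1` satisfies (3.35) for every cube class, every `C > 0` (`u = 1`, `A = 0`; `L, η > 0`). [cite: Balaban1985RegularSpaces, p.98, (1.33) p.82; Balaban1985BackgroundPropagators, (3.35) p.396] -/
theorem reg335Zd_one [NormOneClass 𝔸] {η : ℝ} (hη : 0 < η) {L : ℕ} (hL : 1 ≤ L) (𝒬 : Set (Set (Site d) × ℕ)) {C : ℝ} (hC : 0 < C) :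
    Reg335Zd η L 𝒬 C (1 : Site d → Fin d → 𝔸ˣ) := by
  rw [reg335Zd_iff]
  intro q _
  have hLr : (0 : ℝ) < (L : ℝ) := by exact_mod_cast hL
  have hξ : 0 < scaleLen (L : ℝ) η q.2 := scaleLen_pos hLr hη q.2
  refine ⟨1, 0, fun z _ => ⟨?_, ?_⟩, fun κ z _ => ?_, fun κ z _ => ?_, fun κ ν z _ => ?_⟩
  · simp
  · simp
  · rw [fluct_zero]
    simp [byDir, gaugeAct]
  · simp only [Pi.zero_apply, norm_zero]
    positivity
  · have h0 : covD (shiftT d) (fun _ _ => (1 : 𝔸ˣ)) κ ((0 : Fin d → Site d → 𝔸) ν) z = 0 := covD_zero _ _ κ z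
    rw [h0, smul_zero, norm_zero]
    positivity

end Reg

/-! ## §3 (1.33)–(1.35) with their bodies, as one conjunction -/

section Hyp

variable {𝔸 : Type*} [NormedRing 𝔸] [NormedAlgebra ℂ 𝔸] [CompleteSpace 𝔸]

/-- **(1.33)** «U₀ ∈ 𝔄_k({Ω_j}, α₀), U₀ satisfies the regularity condition (3.35) in [4]». [cite: Balaban1985RegularSpaces, (1.33) p.82, (1.7)–(1.9) p.77; Balaban1985BackgroundPropagators, (3.35) p.396] -/
def Hyp133 (L k : ℕ) (η α₀ : ℝ) (Ω : ℕ → Set (Site d)) (𝒬 : Set (Set (Site d) × ℕ)) (C : ℝ) (U₀ : Site d → Fin d → 𝔸ˣ) : Prop :=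
  InAk L k η α₀ Ω U₀ ∧ Reg335Zd η L 𝒬 C U₀

/-- **(1.34)** «U′U₀ ∈ 𝔄_k({Ω_j}, α₀) ∩ Ax_k(𝔅_k, U₀)». [cite: Balaban1985RegularSpaces, (1.34) p.82, (1.7)–(1.9) p.77, (1.19)–(1.20) p.79] -/
def Hyp134 (L k : ℕ) (η α₀ : ℝ) (Ω Λ : ℕ → Set (Site d)) (U₀ U' : Site d → Fin d → 𝔸ˣ) : Prop :=
  InAk L k η α₀ Ω (U' * U₀) ∧ InAx L k Λ U₀ (U' * U₀)

/-- **(1.35)** «|(U′U₀)‾ʲ − Ū₀ʲ| < α₁ on Λ_j, j = 0, 1, …, k» — the iterated [3] averages of `U′U₀` and of `U₀` on every level-`j` bond of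
`Λ_j` (p. 77 convention: at least one end-point in `Λ_j`). [cite: Balaban1985RegularSpaces, (1.35) p.82, p.77 (bond convention)] -/
def Hyp135 (L k : ℕ) (Λ : ℕ → Set (Site d)) (α₁ : ℝ) (U₀ U' : Site d → Fin d → 𝔸ˣ) : Prop :=
  ∀ j, j ≤ k → ∀ (y : Site d) (κ : Fin d), (y, κ) ∈ bondsOn Λ j →
    ‖((avgIter L (U' * U₀) j y κ : 𝔸ˣ) : 𝔸) - (avgIter L U₀ j y κ : 𝔸ˣ)‖ < α₁

/-- **(1.33)–(1.35), THE HYPOTHESES OF THEOREMS 2 AND 4, AS ONE CONJUNCTION** («We assume that: …»). [cite: Balaban1985RegularSpaces, (1.33)–(1.35) p.82, Thm 2 p.83, Thm 4 p.88] -/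
def Hyp133to135 (L k : ℕ) (η α₀ α₁ : ℝ) (Ω Λ : ℕ → Set (Site d)) (𝒬 : Set (Set (Site d) × ℕ)) (C : ℝ)
    (U₀ U' : Site d → Fin d → 𝔸ˣ) : Prop :=
  Hyp133 L k η α₀ Ω 𝒬 C U₀ ∧ Hyp134 L k η α₀ Ω Λ U₀ U' ∧ Hyp135 L k Λ α₁ U₀ U'

variable {L k : ℕ} {η α₀ α₁ : ℝ} {Ω Λ : ℕ → Set (Site d)} {𝒬 : Set (Set (Site d) × ℕ)} {C : ℝ} {U₀ U' : Site d → Fin d → 𝔸ˣ}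

/-- Unfolding of (1.33)–(1.35): the five printed clauses. [cite: Balaban1985RegularSpaces, (1.33)–(1.35) p.82] -/
theorem hyp133to135_iff :
    Hyp133to135 L k η α₀ α₁ Ω Λ 𝒬 C U₀ U' ↔
      InAk L k η α₀ Ω U₀ ∧ Reg335Zd η L 𝒬 C U₀ ∧ InAk L k η α₀ Ω (U' * U₀) ∧ InAx L k Λ U₀ (U' * U₀) ∧
        ∀ j, j ≤ k → ∀ (y : Site d) (κ : Fin d), (y, κ) ∈ bondsOn Λ j →
          ‖((avgIter L (U' * U₀) j y κ : 𝔸ˣ) : 𝔸) - (avgIter L U₀ j y κ : 𝔸ˣ)‖ < α₁ := by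
  simp only [Hyp133to135, Hyp133, Hyp134, Hyp135, and_assoc]

/-- (1.33)₁: `U₀ ∈ 𝔄_k({Ω_j}, α₀)`. [cite: Balaban1985RegularSpaces, (1.33) p.82] -/
theorem Hyp133to135.inAk_bg (h : Hyp133to135 L k η α₀ α₁ Ω Λ 𝒬 C U₀ U') : InAk L k η α₀ Ω U₀ := h.1.1

/-- (1.33)₂: «U₀ satisfies the regularity condition (3.35) in [4]». [cite: Balaban1985RegularSpaces, (1.33) p.82; Balaban1985BackgroundPropagators, (3.35) p.396] -/
theorem Hyp133to135.reg335 (h : Hyp133to135 L k η α₀ α₁ Ω Λ 𝒬 C U₀ U') : Reg335Zd η L 𝒬 C U₀ := h.1.2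

/-- (1.34)₁: `U′U₀ ∈ 𝔄_k({Ω_j}, α₀)`. [cite: Balaban1985RegularSpaces, (1.34) p.82] -/
theorem Hyp133to135.inAk (h : Hyp133to135 L k η α₀ α₁ Ω Λ 𝒬 C U₀ U') : InAk L k η α₀ Ω (U' * U₀) := h.2.1.1

/-- (1.34)₂: `U′U₀ ∈ Ax_k(𝔅_k, U₀)`. [cite: Balaban1985RegularSpaces, (1.34) p.82, (1.19)–(1.20) p.79] -/
theorem Hyp133to135.inAx (h : Hyp133to135 L k η α₀ α₁ Ω Λ 𝒬 C U₀ U') : InAx L k Λ U₀ (U' * U₀) := h.2.1.2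

/-- (1.35). [cite: Balaban1985RegularSpaces, (1.35) p.82] -/
theorem Hyp133to135.hyp135 (h : Hyp133to135 L k η α₀ α₁ Ω Λ 𝒬 C U₀ U') : Hyp135 L k Λ α₁ U₀ U' := h.2.2

/-- (1.35) in the `≦` form used on box regions by the (1.65) files (`B8Ineq165Local.ineq165_local`, hypothesis `h35`).
[cite: Balaban1985RegularSpaces, (1.35) p.82, (1.65) p.87] -/
theorem Hyp135.norm_sub_le (h : Hyp135 L k Λ α₁ U₀ U') {j : ℕ} (hj : j ≤ k) {y : Site d} {κ : Fin d}
    (hb : (y, κ) ∈ bondsOn Λ j) :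
    ‖((avgIter L (U' * U₀) j y κ : 𝔸ˣ) : 𝔸) - (avgIter L U₀ j y κ : 𝔸ˣ)‖ ≤ α₁ :=
  (h j hj y κ hb).le

/-- **p. 82: «The condition (1.35) replaces the equalities for the averages in the conditions (1.28). It is satisfied if V is close to Ū₀ʲ,
more precisely if |V − Ū₀ʲ| < α₁»** — PROVED: if `U′U₀ ∈ 𝔅_k(𝔅_k, V)` ((1.13)/(1.28): `(U′U₀)‾ʲ = V` on the bonds of `Λ_j`, r13's
`B8Eq113ClassBk.InBk`) and `|V − Ū₀ʲ| < α₁` on the bonds of `Λ_j`, `j ≤ k`, then (1.35). [cite: Balaban1985RegularSpaces, p.82 (sentence after (1.35)), (1.35) p.82, (1.13) p.78, (1.28) p.81] -/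
theorem hyp135_of_inBk {V : ℕ → Site d → Fin d → 𝔸ˣ} (hB : InBk L k Λ V (U' * U₀))
    (hV : ∀ j, j ≤ k → ∀ (y : Site d) (κ : Fin d), (y, κ) ∈ bondsOn Λ j →
      ‖((V j y κ : 𝔸ˣ) : 𝔸) - (avgIter L U₀ j y κ : 𝔸ˣ)‖ < α₁) :
    Hyp135 L k Λ α₁ U₀ U' := by
  intro j hj y κ hb
  have hEq : avgIter L (U' * U₀) j y κ = V j y κ := (inBk_iff L k Λ V (U' * U₀)).1 hB j hj y κ hb
  rw [hEq]
  exact hV j hj y κ hb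

end Hyp

/-! ## §4 Non-vacuity: the pair `U₀ = 1`, `U′ = 1` -/

section One

variable {𝔸 : Type*} [NormedRing 𝔸] [NormOneClass 𝔸] [NormedAlgebra ℂ 𝔸] [CompleteSpace 𝔸]

omit [NormOneClass 𝔸] in
/-- (1.35) for the pair `1, 1`: both averages are `1`. [cite: Balaban1985RegularSpaces, (1.35) p.82, p.98] -/
theorem hyp135_one (L k : ℕ) (Λ : ℕ → Set (Site d)) {α₁ : ℝ} (hα₁ : 0 < α₁) :
    Hyp135 L k Λ α₁ (1 : Site d → Fin d → 𝔸ˣ) 1 := by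
  intro j _ y κ _
  rw [mul_one, avgIter_one]
  simpa using hα₁

/-- **THE HYPOTHESES (1.33)–(1.35) ARE INHABITED**: the pair `U₀ = 1`, `U′ = 1` satisfies them for every domain data, every cube class and
every `α₀, α₁, C > 0` (`L ≥ 1`, `η > 0`) — p. 98 «identically equal to 1 satisfies, of course, all possible regularity conditions»; (1.34)₂ by
p40's `inAx_self` («the surfaces pass through the element U₀», p. 78). [cite: Balaban1985RegularSpaces, (1.33)–(1.35) p.82, p.78, p.98] -/
theorem hyp133to135_one {L : ℕ} (hL : 1 ≤ L) (k : ℕ) {η α₀ α₁ C : ℝ} (hη : 0 < η) (hα₀ : 0 < α₀) (hα₁ : 0 < α₁) (hC : 0 < C)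
    (Ω Λ : ℕ → Set (Site d)) (𝒬 : Set (Set (Site d) × ℕ)) :
    Hyp133to135 L k η α₀ α₁ Ω Λ 𝒬 C (1 : Site d → Fin d → 𝔸ˣ) 1 := by
  refine ⟨⟨one_inAk hL k hη hα₀ Ω, reg335Zd_one hη hL 𝒬 hC⟩, ⟨?_, ?_⟩, hyp135_one L k Λ hα₁⟩
  · rw [mul_one]; exact one_inAk hL k hη hα₀ Ω
  · rw [mul_one]; exact inAx_self L k Λ 1

end One

end

end Literature.MathematicalPhysics.QuantumFieldTheory.Balaban1983to89.B8Eq133Hypotheses
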